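import Summits.AtomisticToContinuum.Crystallization.Theses.BraggSlacknessRigidity

/-!
# The commensurate hcp case is a special case of hcp diffraction rigidity

Route `BraggSlacknessRigidity` (sub-problem `Crystallization`), item `stmt-AtomisticToContinuum-13171`
(`CommensurateOfHcp := HcpDiffractionRigidity → CommensurateHcpRigidity`).

`CommensurateHcpRigidity` is, clause by clause, the statement `HcpDiffractionRigidity` with the
template hypothesis `∃ a h (ha : a ≠ 0) (hh : h ≠ 0), P = hcpPeriodicConfiguration ha hh`
strengthened by the extra commensurability conjunct `∃ q : ℚ, h ^ 2 = q * a ^ 2`.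
PROOF. Given the general rigidity statement and a commensurate hcp template `P`, forget the
commensurability witness and apply the general statement to `P`; every remaining binder is
identical.
-/

namespace Summit.AtomisticToContinuum.Crystallization.Theorems

open Summit.AtomisticToContinuum.Crystallization.Theses

/-- Item `stmt-AtomisticToContinuum-13171` (`CommensurateOfHcp`): hcp diffraction rigidity for all
hcp templates implies it for the commensurate ones (`h² = q a²`, `q ∈ ℚ`) — drop the commensurability
conjunct of the template hypothesis. -/
theorem commensurateOfHcp_proof : BraggSlacknessRigidity.CommensurateOfHcp := by
  unfold BraggSlacknessRigidity.CommensurateOfHcp BraggSlacknessRigidity.CommensurateHcpRigidity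
  intro hR P hP
  obtain ⟨a, h, ha, hh, hPe, -⟩ := hP
  exact hR P ⟨a, h, ha, hh, hPe⟩

end Summit.AtomisticToContinuum.Crystallization.Theorems
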